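import Summits.ABC.IUTFork.Conditional.AbcExpOfSigmaMassContent
import Summits.ABC.IUTFork.Conditional.AbcExpOfSigmaMassDegOne
import Summits.ABC.IUTFork.Repair.RHInSigmaDatum
import Summits.ABC.IUTFork.Repair.RHSlotReachSigma
import Summits.ABC.IUTFork.Repair.RH2SigmaHullChosen
import HarnessLib

/-!
# R-H ROUND 2, Q2 hull-reach family × EXPONENT PROGRAMME F5: the σ-INSTANCES OF THE ENDPOINT WITH THE LICENCE BINDER DISCHARGED —
# «S|Σ_data is a THEOREM ⟹ abc WITH EXPONENT `1/μ₀` ON EVERY FAR-FROM-CUSPS FAMILY from the MASS hypothesis on Σ_data alone (+ the θ-cut cone)»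

PROOF-ONLY file (D-0012: 0 definitions, 0 `Prop` facts, no instance, no notation; abc-iut cell, rung LADDER-ABC:A2.RESCUE.H; seat abc-iut-rh2-q2-hull gen 5;
sequel of p469248 / p469830 (doors) and of abc-iut-rh2-T-1's F5 (a) ENDPOINT p485274 `Conditional.SigmaMass.abcExpOn_farFromCusps_of_licenceOn_mu_content_hregC`).
TAKES NO SIDE on [IUTchIII] Cor. 3.12 or on any author; nothing asserts abc proved or refuted; typed ≠ proved.

THE POINT. F5 (a) reads, for a FREE stratum `σ(P,l,T)`: [LIC-C] «the (xi-f) licence holds on `σ` at every content-locus datum» · [MU-C] «`σ` retains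
`≥ μ₀·T.gap − Tol(P,l)` of the `(j²−1)`-mass» · [CONE-C] `hregC` ⟹ `∀ ρ ∈ (0,½], ABCWithExponentOn {λ ρ-far from the cusps} (1/μ₀)`. For THREE strata the
licence binder [LIC-C] is NOT a hypothesis but a THEOREM of the tree, so the endpoint holds with it DISCHARGED:

* §1 (any datum, at the chosen realising ideles of the genuine `K`-level bed). `Σ_lic(T)` := abc-iut-rh2-q2-eq's `RH.SigmaLicence.licenceCells` — the cells
  OUR typed hull licenses; the licence on it is true BY DEFINITION (`licenceOn_licenceCells`) and every licensed `σ` lies inside it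
  (`licenceOn_iff_subset_licenceCells`), so its discarded mass is the LEAST: `offTrivialMass_licenceCells_le_of_licenceOn_chosen` (abc-iut-rh2-T-1's
  `offTrivialMass_anti` under abc-iut-c312-6's bridge hypotheses, theorems at this bed). Row 18's `Σ₁₈(T)` (abc-iut-rh2-xi-2's
  `RH.InSigmaDatum.sigmaLevelWindow`, DICTIONARY-FREE) and row 15's `Σ₁₅(T; n₀, λ, m_q)` (abc-iut-rh-typ-12's `RHSlotReach.sigmaSlotReach` for a CERTIFIED
  dictionary) are licensed strata: `licenceOn_sigmaLevelWindow_chosen`, `licenceOn_sigmaSlotReach_chosen` (this seat's door p469830).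
* §2 THE HYPOTHESIS-MINIMAL ENDPOINTS, `σ := Σ_lic`: `abcExpOn_farFromCusps_of_mu_licenceCells_content_hregC` — explicit 2 = [MU-C at Σ_lic]·[CONE-C];
  `abcExpOn_farFromCusps_of_mu_licenceCells_szpiroBad_degOne` — CONE-FREE, explicit 1 = [MU₁-bad at Σ_lic] ALONE: «if at every genuine Θ-volume datum of every
  Szpiro-bad admissible RATIONAL `(λ, l)` the cells OUR hull licenses retain `≥ μ₀·gap − Tol` of the mass, then abc with exponent `1/μ₀` on every far-from-cusps
  family»; `abc_exp_three_div_of_mu_licenceCells_content_hregC` — all triples, exponent `3/μ₀` (p483681 shape (c)). Since any `(σ, [LIC σ], [MU σ])` gives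
  [MU Σ_lic] (§1), these IMPLY the F5 endpoints for every `σ` — and conversely ARE F5 at `σ := Σ_lic`: the strongest members of the family, binder by binder.
  The per-row instances (Σ₁₈, Σ₁₅ — `μ` COMPUTABLE from the datum, MIN-SLICE §(v)) are the companion `Repair/RH2SigmaHullExponentRows.lean`.

BINDER STATUS (numbers, names; no side). [MU-C at Σ_lic] asks `μ_lic(T) := mass(Σ_lic(T))/T.gap ≥ μ₀ − Tol/T.gap` on the content locus
(«`6·(1+20·d_mod/l)·(log-diff + log-cond) + 120·d*·l < log q^{∤{2,l}}`», `d* = 2¹²·3³·5·d_mod`: `log q > 8.6·10⁸` at `(d_mod, l) = (1, 13)`) — NO tabulated datum lies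
there (rh-lead B23: every table misses it by a factor `≥ 7·10⁶`), so the content-cut forms engage no known datum and `Conditional.not_hreg_v4` /
`RH2SigmaHull.frey13_not_*` do not bear on them; [MU₁-bad at Σ_lic] IS engaged at the tier-1 Frey–Legendre data `(λ₃₆₇₇, 13)` of p480214, where the full licence
FAILS (`frey13_not_of_door`: `Σ_lic ≠ univ` there) and `μ_lic` is undecided as typed (measured slice fractions of record, NOT theorems: FREY-133 median `0.52`,
exact envelope `0.84`). At each datum [MU] holds for free at `μ₀ := μ_lic(T)` (abc-iut-rh2-w-1 `offSigmaTolerance_offTrivialMass_massFrac_chosen`); whether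
`inf μ_lic > 0` over the content locus is OPEN (round 3). «Follows from these hypotheses AS TYPED», nothing more; instantiated ≠ endorsed.
[claim: Mochizuki2012, status: disputed] [cite: Mochizuki2012, IUTchIII Cor. 3.12 p. 173–174, Step (xi-f) p. 184; IUTchIV Thm. 1.10 pp. 22–31, Cor. 2.2 (ii)–(iii)
pp. 41–48 (application of Thm. 1.10: p. 46 l. 43–50)] [cite: MochizukiGenEll2010, Thm 2.1 p.11–12] [cite: DupuyHilado2025, §3.9, §4.9]
-/

noncomputable section

open Set Function
namespace Summit.ABC.IUTFork.Repair.RH2SigmaHull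

open Thm311 Thm311.Real Cor312 Cor312.Setting Cor312Vol Cor312Prov Literature.IUT.LogThetaLattice Literature.IUT.LogVolume
  Literature.IUT.HodgeTheaters Literature.IUT.LogVolume.ThetaData
open Literature.NumberTheory.NumberFields NumberField IsDedekindDomain Metric RHSlotReach RH RH.InSigmaDatum RH.SigmaLicence RH.SigmaMass RH.OffSigma
open Literature.NumberTheory.DiophantineGeometry Literature.NumberTheory.DiophantineGeometry.GenEll Summit.ABC.ABC.Theorems Conditional Conditional.SigmaMass

/-! ## §1. One genuine datum, CHOSEN realising ideles: Σ_lic discards least; Σ₁₈ and Σ₁₅ are licensed strata (the [LIC] binder as a theorem) -/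

section Datum

variable {F K Fbar : Type} [Field F] [NumberField F] [Field K] [NumberField K] [Algebra F K] [Field Fbar]
  [Algebra F Fbar] [Algebra K Fbar] {E : WeierstrassCurve F} [E.IsElliptic] {l : ℕ} {Pb : BadPlacePredicates K}
  (D : InitialThetaData F K Fbar E l Pb)
  (M : Type) [Field M] [NumberField M]
  (archPk : ∀ (j : (thetaIndex (pilotDataOfK D K)).Label) (vQ : (thetaIndex (pilotDataOfK D K)).VQ),
    Set ((logShellsDH (pilotDataOfK D K) (analyticLogv K)).Packet j vQ))
  (archSub : ∀ (j : (thetaIndex (pilotDataOfK D K)).Label) (v : (thetaIndex (pilotDataOfK D K)).V),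
    Set ((logShellsDH (pilotDataOfK D K) (analyticLogv K)).Packet j ((thetaIndex (pilotDataOfK D K)).over v)))
  (Ψ : ℤ → ∀ v : (thetaIndex (pilotDataOfK D K)).V, v ∈ (thetaIndex (pilotDataOfK D K)).Vbad →
    Set ((logShellsDH (pilotDataOfK D K) (analyticLogv K)).StarPacket v))
  (act : ℤ → ∀ v : (thetaIndex (pilotDataOfK D K)).V, v ∈ (thetaIndex (pilotDataOfK D K)).Vbad →
    (logShellsDH (pilotDataOfK D K) (analyticLogv K)).StarPacket v →
      Module.End ℚ ((logShellsDH (pilotDataOfK D K) (analyticLogv K)).StarPacket v))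
  (Mmod : ℤ → ∀ j : (thetaIndex (pilotDataOfK D K)).LabelStar, Set ((logShellsDH (pilotDataOfK D K) (analyticLogv K)).GlobalPacket j.1))
  (region : ℤ → ∀ j : (thetaIndex (pilotDataOfK D K)).LabelStar, FinDivisor M → ∀ vQ : (thetaIndex (pilotDataOfK D K)).VQ,
    Set ((logShellsDH (pilotDataOfK D K) (analyticLogv K)).Packet j.1 vQ))
  (n : ℤ) {HT : Type} {LogLink : HT → HT → Type} {IsFull : ∀ {s t : HT}, LogLink s t → Prop}
  (lat : LGPGaussianLogThetaLattice LogLink IsFull)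
  {Frd : Type} {IsoF : Frd → Frd → Type} {Ob : Frd → Type} {realify : Frd → Frd} {Strip : Type}
  {IsoS : Strip → Strip → Type}
  {Mv : ∀ v : (thetaIndex (pilotDataOfK D K)).V, v ∈ (thetaIndex (pilotDataOfK D K)).Vbad → Type} [∀ v h, Monoid (Mv v h)]
  (sig : GlobalLGPFrobenioidSignature (thetaIndex (pilotDataOfK D K)).lstar (thetaIndex (pilotDataOfK D K)).V
    (· ∈ (thetaIndex (pilotDataOfK D K)).Vbad) Frd IsoF Ob realify Strip IsoS Mv)
  (split : SplittingMonoids Mv) {ObΔ : Type}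
  {N : ∀ v : (thetaIndex (pilotDataOfK D K)).V, v ∈ (thetaIndex (pilotDataOfK D K)).Vbad → Type} [∀ v h, Monoid (N v h)]
  (qData : QPilotData ObΔ N)

/-- **Σ_lic DISCARDS LEAST.** At the genuine bed `pilotDataOfK D K` with the CHOSEN realising ideles, every licensed stratum `σ` (`LicenceOn … σ`) lies inside
`Σ_lic := licenceCells` (abc-iut-rh2-q2-eq `licenceOn_iff_subset_licenceCells`), hence `B_triv(Σ_licᶜ) ≤ B_triv(σᶜ)` (abc-iut-rh2-T-1 `offTrivialMass_anti`; abc-iut-c312-6's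
bridge hypotheses are theorems here, `bridgeHyps_settingPrVolSharp_of_ideles`). So F5's pair ([LIC σ], [MU σ]) always yields [MU Σ_lic]. [claim: Mochizuki2012, status: disputed] -/
theorem offTrivialMass_licenceCells_le_of_licenceOn_chosen
    (σ : Set (Fin (thetaIndex (pilotDataOfK D K)).lstar × (thetaIndex (pilotDataOfK D K)).VQ))
    (hσ : LicenceOn (settingPrVolSharp (pilotDataOfK D K) (logvAnalytic_analyticLogv (F := K)) M archPk archSub Ψ act Mmod region n lat sig split qData
        (exists_realising_qIdeles_pilotDataOfK D).choose (exists_realising_thetaIdeles_pilotDataOfK D).choose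
        (exists_realising_qIdeles_pilotDataOfK D).choose_spec.1 (exists_realising_qIdeles_pilotDataOfK D).choose_spec.2.1) σ) :
    offTrivialMass (settingPrVolSharp (pilotDataOfK D K) (logvAnalytic_analyticLogv (F := K)) M archPk archSub Ψ act Mmod region n lat sig split qData
        (exists_realising_qIdeles_pilotDataOfK D).choose (exists_realising_thetaIdeles_pilotDataOfK D).choose
        (exists_realising_qIdeles_pilotDataOfK D).choose_spec.1 (exists_realising_qIdeles_pilotDataOfK D).choose_spec.2.1)
      (licenceCells (settingPrVolSharp (pilotDataOfK D K) (logvAnalytic_analyticLogv (F := K)) M archPk archSub Ψ act Mmod region n lat sig split qData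
        (exists_realising_qIdeles_pilotDataOfK D).choose (exists_realising_thetaIdeles_pilotDataOfK D).choose
        (exists_realising_qIdeles_pilotDataOfK D).choose_spec.1 (exists_realising_qIdeles_pilotDataOfK D).choose_spec.2.1)) ≤
    offTrivialMass (settingPrVolSharp (pilotDataOfK D K) (logvAnalytic_analyticLogv (F := K)) M archPk archSub Ψ act Mmod region n lat sig split qData
        (exists_realising_qIdeles_pilotDataOfK D).choose (exists_realising_thetaIdeles_pilotDataOfK D).choose
        (exists_realising_qIdeles_pilotDataOfK D).choose_spec.1 (exists_realising_qIdeles_pilotDataOfK D).choose_spec.2.1) σ :=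
  offTrivialMass_anti
    (bridgeHyps_settingPrVolSharp_of_ideles (pilotDataOfK D K) (logvAnalytic_analyticLogv (F := K)) M archPk archSub Ψ act Mmod region n lat sig
      split qData (exists_realising_thetaIdeles_pilotDataOfK D).choose (exists_realising_qIdeles_pilotDataOfK D).choose
      (exists_realising_thetaIdeles_pilotDataOfK D).choose_spec.1 (exists_realising_thetaIdeles_pilotDataOfK D).choose_spec.2.1
      (exists_realising_qIdeles_pilotDataOfK D).choose_spec.1 (exists_realising_qIdeles_pilotDataOfK D).choose_spec.2.1)
    (licenceOn_iff_subset_licenceCells.mp hσ)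

/-- **Σ₁₈(T) IS A LICENSED STRATUM (dictionary-free).** At the genuine bed with the chosen realising ideles the (xi-f) licence holds on row 18's level window
`Σ₁₈ := sigmaLevelWindow (pilotDataOfK D K) t_q t_Θ` — abc-iut-rh2-xi-2's `licenceAt_of_mem_sigmaLevelWindow` cell by cell (M1 movers by `moverOfLevel_holds`; every
certificate inside the clause). So F5's [LIC] at `σ := Σ₁₈` is a theorem. [cite: DupuyHilado2025, §3.9, §4.9] [claim: Mochizuki2012, status: disputed] -/
theorem licenceOn_sigmaLevelWindow_chosen :
    LicenceOn (settingPrVolSharp (pilotDataOfK D K) (logvAnalytic_analyticLogv (F := K)) M archPk archSub Ψ act Mmod region n lat sig split qData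
        (exists_realising_qIdeles_pilotDataOfK D).choose (exists_realising_thetaIdeles_pilotDataOfK D).choose
        (exists_realising_qIdeles_pilotDataOfK D).choose_spec.1 (exists_realising_qIdeles_pilotDataOfK D).choose_spec.2.1)
      (sigmaLevelWindow (pilotDataOfK D K) (exists_realising_qIdeles_pilotDataOfK D).choose (exists_realising_thetaIdeles_pilotDataOfK D).choose) :=
  fun c hc => licenceAt_of_mem_sigmaLevelWindow (pilotDataOfK D K) (logvAnalytic_analyticLogv (F := K)) M archPk archSub Ψ act Mmod region n lat
    sig split qData (exists_realising_qIdeles_pilotDataOfK D).choose (exists_realising_thetaIdeles_pilotDataOfK D).choose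
    (exists_realising_qIdeles_pilotDataOfK D).choose_spec.1 (exists_realising_qIdeles_pilotDataOfK D).choose_spec.2.1 c.1 c.2 hc

/-- **Σ₁₅(T; n₀, λ, m_q) IS A LICENSED STRATUM (certified dictionary).** At the genuine bed with the chosen realising ideles, for a CERTIFIED window dictionary —
inner bounds `n₀(x)` (a non-log-unit of norm `≤ p^{−(n₀(x)−1)/e_x}`), outer radii `λ(x)` (a log-unit of norm `≥ p^{λ(x)}`), INTEGER Kummer orders `m_q(w) = P_q(w)` at
the bad places (`e_x = ramIdx`, `m_Θ = j²·m_q`: the realising profile) — the (xi-f) licence holds on row 15's slot-reach window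
`Σ₁₅ := sigmaSlotReach (pilotDataOfK D K) ramIdx n₀ λ (j²·m_q) m_q` (abc-iut-rh-typ-12's def): this seat's door `qRegion_subset_thetaHull_chosen_of_slotReachOn`
(p469830) at the packet stratum «the slot-reach clause holds at `(p, i)`». So F5's [LIC] at `σ := Σ₁₅` is a theorem modulo the three certificates.
[cite: DupuyHilado2025, §3.3, §3.4, §3.9, §4.9] [claim: Mochizuki2012, status: disputed] -/
theorem licenceOn_sigmaSlotReach_chosen
    (n₀ : ∀ pp : Nat.Primes, (thetaIndex (pilotDataOfK D K)).Fibre (.inr pp) → ℕ)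
    (lam : ∀ pp : Nat.Primes, (thetaIndex (pilotDataOfK D K)).Fibre (.inr pp) → ℝ)
    (mq : ∀ pp : Nat.Primes, (thetaIndex (pilotDataOfK D K)).Fibre (.inr pp) → ℤ)
    (hn₀ : ∀ (pp : Nat.Primes) (x : (thetaIndex (pilotDataOfK D K)).Fibre (.inr pp)), haveI : Fact (pp : ℕ).Prime := ⟨pp.2⟩
      ∃ u : kOf (pilotDataOfK D K) pp.1 x,
        ‖u‖ ≤ (pp : ℝ) ^ (-(((n₀ pp x : ℤ) - 1 : ℤ) : ℝ) / (ramIdx K (placeOf (pilotDataOfK D K) pp.1 x) : ℝ)) ∧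
          u ∉ (logUnits (kOf (pilotDataOfK D K) pp.1 x) : Set (kOf (pilotDataOfK D K) pp.1 x)))
    (hlam : ∀ (pp : Nat.Primes) (x : (thetaIndex (pilotDataOfK D K)).Fibre (.inr pp)), haveI : Fact (pp : ℕ).Prime := ⟨pp.2⟩
      ∃ z ∈ (logUnits (kOf (pilotDataOfK D K) pp.1 x) : Set (kOf (pilotDataOfK D K) pp.1 x)), (pp : ℝ) ^ (lam pp x) ≤ ‖z‖)
    (hmq : ∀ (pp : Nat.Primes) (w : (thetaIndex (pilotDataOfK D K)).Fibre (.inr pp)), haveI : Fact (pp : ℕ).Prime := ⟨pp.2⟩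
      placeOf (pilotDataOfK D K) pp.1 w ∈ (pilotDataOfK D K).S →
        (mq pp w : ℝ) = (pilotDataOfK D K).qPilot (placeOf (pilotDataOfK D K) pp.1 w)) :
    LicenceOn (settingPrVolSharp (pilotDataOfK D K) (logvAnalytic_analyticLogv (F := K)) M archPk archSub Ψ act Mmod region n lat sig split qData
        (exists_realising_qIdeles_pilotDataOfK D).choose (exists_realising_thetaIdeles_pilotDataOfK D).choose
        (exists_realising_qIdeles_pilotDataOfK D).choose_spec.1 (exists_realising_qIdeles_pilotDataOfK D).choose_spec.2.1)
      (sigmaSlotReach (pilotDataOfK D K) (fun pp x => haveI : Fact (pp : ℕ).Prime := ⟨pp.2⟩; ramIdx K (placeOf (pilotDataOfK D K) pp.1 x)) n₀ lam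
        (fun pp i w => ((((i : ℕ) : ℤ) + 1) ^ 2) * mq pp w) mq) := by
  intro c hc
  refine qRegion_subset_thetaHull_chosen_of_slotReachOn D M archPk archSub Ψ act Mmod region n lat sig split qData n₀ lam mq hn₀ hlam hmq
    (fun pp i => SlotReachPacket (thetaIndex (pilotDataOfK D K)).lstar (fun pp => (thetaIndex (pilotDataOfK D K)).Fibre (.inr pp))
      (fun pp w => haveI : Fact (pp : ℕ).Prime := ⟨pp.2⟩; placeOf (pilotDataOfK D K) pp.1 w ∈ (pilotDataOfK D K).S)
      (fun pp x => haveI : Fact (pp : ℕ).Prime := ⟨pp.2⟩; ramIdx K (placeOf (pilotDataOfK D K) pp.1 x)) n₀ lam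
      (fun pp i w => ((((i : ℕ) : ℤ) + 1) ^ 2) * mq pp w) mq pp i)
    (fun pp i h w hw x => h w hw x) (labelSucc c.1) c.2 fun pp i hv hj => ?_
  obtain ⟨i₀, vQ⟩ := c
  cases Fin.succ_injective _ hj
  exact hc pp hv

end Datum

/-! ## §2. The family: F5's endpoints at `σ := Σ_lic` — the licence binder GONE, the mass binder on the LICENSED cells the only Σ-hypothesis -/

section Exponent

/-! The certificates' column data (the binders `M … qData` of the F5 endpoint, VERBATIM), once for the whole section. -/
variable (M : ∀ (P : NFPoint) (l : ℕ) (T : Cor22.ThetaVolumeDatumAt P l), Type) [∀ P l T, Field (M P l T)] [∀ P l T, NumberField (M P l T)]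
    (archPk : ∀ (P : NFPoint) (l : ℕ) (T : Cor22.ThetaVolumeDatumAt P l), letI := T.instFieldF; letI := T.instNumberFieldF; letI := T.instAlgebraF; letI := T.instFieldK;
        letI := T.instNumberFieldK; letI := T.instAlgebraK; letI := T.instFieldFbar; letI := T.instAlgebraFbar;
        letI := T.instAlgebraKFbar; letI := T.instIsElliptic;
      ∀ (j : (thetaIndex (pilotDataOfK T.D T.K)).Label) (vQ : (thetaIndex (pilotDataOfK T.D T.K)).VQ), Set ((logShellsDH (pilotDataOfK T.D T.K) (analyticLogv T.K)).Packet j vQ))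
    (archSub : ∀ (P : NFPoint) (l : ℕ) (T : Cor22.ThetaVolumeDatumAt P l), letI := T.instFieldF; letI := T.instNumberFieldF; letI := T.instAlgebraF; letI := T.instFieldK;
        letI := T.instNumberFieldK; letI := T.instAlgebraK; letI := T.instFieldFbar; letI := T.instAlgebraFbar;
        letI := T.instAlgebraKFbar; letI := T.instIsElliptic;
      ∀ (j : (thetaIndex (pilotDataOfK T.D T.K)).Label) (v : (thetaIndex (pilotDataOfK T.D T.K)).V), Set ((logShellsDH (pilotDataOfK T.D T.K) (analyticLogv T.K)).Packet j ((thetaIndex (pilotDataOfK T.D T.K)).over v)))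
    (Ψ : ∀ (P : NFPoint) (l : ℕ) (T : Cor22.ThetaVolumeDatumAt P l), letI := T.instFieldF; letI := T.instNumberFieldF; letI := T.instAlgebraF; letI := T.instFieldK;
        letI := T.instNumberFieldK; letI := T.instAlgebraK; letI := T.instFieldFbar; letI := T.instAlgebraFbar;
        letI := T.instAlgebraKFbar; letI := T.instIsElliptic;
      ℤ → ∀ v : (thetaIndex (pilotDataOfK T.D T.K)).V, v ∈ (thetaIndex (pilotDataOfK T.D T.K)).Vbad → Set ((logShellsDH (pilotDataOfK T.D T.K) (analyticLogv T.K)).StarPacket v))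
    (act : ∀ (P : NFPoint) (l : ℕ) (T : Cor22.ThetaVolumeDatumAt P l), letI := T.instFieldF; letI := T.instNumberFieldF; letI := T.instAlgebraF; letI := T.instFieldK;
        letI := T.instNumberFieldK; letI := T.instAlgebraK; letI := T.instFieldFbar; letI := T.instAlgebraFbar;
        letI := T.instAlgebraKFbar; letI := T.instIsElliptic;
      ℤ → ∀ v : (thetaIndex (pilotDataOfK T.D T.K)).V, v ∈ (thetaIndex (pilotDataOfK T.D T.K)).Vbad → (logShellsDH (pilotDataOfK T.D T.K) (analyticLogv T.K)).StarPacket v → Module.End ℚ ((logShellsDH (pilotDataOfK T.D T.K) (analyticLogv T.K)).StarPacket v))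
    (Mmod : ∀ (P : NFPoint) (l : ℕ) (T : Cor22.ThetaVolumeDatumAt P l), letI := T.instFieldF; letI := T.instNumberFieldF; letI := T.instAlgebraF; letI := T.instFieldK;
        letI := T.instNumberFieldK; letI := T.instAlgebraK; letI := T.instFieldFbar; letI := T.instAlgebraFbar;
        letI := T.instAlgebraKFbar; letI := T.instIsElliptic;
      ℤ → ∀ j : (thetaIndex (pilotDataOfK T.D T.K)).LabelStar, Set ((logShellsDH (pilotDataOfK T.D T.K) (analyticLogv T.K)).GlobalPacket j.1))
    (region : ∀ (P : NFPoint) (l : ℕ) (T : Cor22.ThetaVolumeDatumAt P l), letI := T.instFieldF; letI := T.instNumberFieldF; letI := T.instAlgebraF; letI := T.instFieldK;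
        letI := T.instNumberFieldK; letI := T.instAlgebraK; letI := T.instFieldFbar; letI := T.instAlgebraFbar;
        letI := T.instAlgebraKFbar; letI := T.instIsElliptic;
      ℤ → ∀ j : (thetaIndex (pilotDataOfK T.D T.K)).LabelStar, FinDivisor (M P l T) → ∀ vQ : (thetaIndex (pilotDataOfK T.D T.K)).VQ, Set ((logShellsDH (pilotDataOfK T.D T.K) (analyticLogv T.K)).Packet j.1 vQ))
    (n : ∀ (P : NFPoint) (l : ℕ) (T : Cor22.ThetaVolumeDatumAt P l), ℤ)
    {HT : ∀ (P : NFPoint) (l : ℕ) (T : Cor22.ThetaVolumeDatumAt P l), Type} {LogLink : ∀ (P : NFPoint) (l : ℕ) (T : Cor22.ThetaVolumeDatumAt P l), HT P l T → HT P l T → Type}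
    {IsFull : ∀ (P : NFPoint) (l : ℕ) (T : Cor22.ThetaVolumeDatumAt P l), ∀ {s t : HT P l T}, LogLink P l T s t → Prop}
    (lat : ∀ (P : NFPoint) (l : ℕ) (T : Cor22.ThetaVolumeDatumAt P l), LGPGaussianLogThetaLattice (LogLink P l T) (IsFull P l T))
    {Frd : ∀ (P : NFPoint) (l : ℕ) (T : Cor22.ThetaVolumeDatumAt P l), Type} {IsoF : ∀ (P : NFPoint) (l : ℕ) (T : Cor22.ThetaVolumeDatumAt P l), Frd P l T → Frd P l T → Type} {Ob : ∀ (P : NFPoint) (l : ℕ) (T : Cor22.ThetaVolumeDatumAt P l), Frd P l T → Type}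
    {realify : ∀ (P : NFPoint) (l : ℕ) (T : Cor22.ThetaVolumeDatumAt P l), Frd P l T → Frd P l T} {Strip : ∀ (P : NFPoint) (l : ℕ) (T : Cor22.ThetaVolumeDatumAt P l), Type} {IsoS : ∀ (P : NFPoint) (l : ℕ) (T : Cor22.ThetaVolumeDatumAt P l), Strip P l T → Strip P l T → Type}
    {Mv : ∀ (P : NFPoint) (l : ℕ) (T : Cor22.ThetaVolumeDatumAt P l), letI := T.instFieldF; letI := T.instNumberFieldF; letI := T.instAlgebraF; letI := T.instFieldK;
        letI := T.instNumberFieldK; letI := T.instAlgebraK; letI := T.instFieldFbar; letI := T.instAlgebraFbar;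
        letI := T.instAlgebraKFbar; letI := T.instIsElliptic;
      ∀ v : (thetaIndex (pilotDataOfK T.D T.K)).V, v ∈ (thetaIndex (pilotDataOfK T.D T.K)).Vbad → Type}
    [∀ P l T v h, Monoid (Mv P l T v h)]
    (sig : ∀ (P : NFPoint) (l : ℕ) (T : Cor22.ThetaVolumeDatumAt P l), letI := T.instFieldF; letI := T.instNumberFieldF; letI := T.instAlgebraF; letI := T.instFieldK;
        letI := T.instNumberFieldK; letI := T.instAlgebraK; letI := T.instFieldFbar; letI := T.instAlgebraFbar;
        letI := T.instAlgebraKFbar; letI := T.instIsElliptic;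
      GlobalLGPFrobenioidSignature (thetaIndex (pilotDataOfK T.D T.K)).lstar (thetaIndex (pilotDataOfK T.D T.K)).V (· ∈ (thetaIndex (pilotDataOfK T.D T.K)).Vbad) (Frd P l T) (IsoF P l T) (Ob P l T) (realify P l T)
        (Strip P l T) (IsoS P l T) (Mv P l T))
    (split : ∀ (P : NFPoint) (l : ℕ) (T : Cor22.ThetaVolumeDatumAt P l), SplittingMonoids (Mv P l T))
    {ObΔ : ∀ (P : NFPoint) (l : ℕ) (T : Cor22.ThetaVolumeDatumAt P l), Type} {N : ∀ (P : NFPoint) (l : ℕ) (T : Cor22.ThetaVolumeDatumAt P l), letI := T.instFieldF; letI := T.instNumberFieldF; letI := T.instAlgebraF; letI := T.instFieldK;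
        letI := T.instNumberFieldK; letI := T.instAlgebraK; letI := T.instFieldFbar; letI := T.instAlgebraFbar;
        letI := T.instAlgebraKFbar; letI := T.instIsElliptic;
      ∀ v : (thetaIndex (pilotDataOfK T.D T.K)).V, v ∈ (thetaIndex (pilotDataOfK T.D T.K)).Vbad → Type}
    [∀ P l T v h, Monoid (N P l T v h)] (qData : ∀ (P : NFPoint) (l : ℕ) (T : Cor22.ThetaVolumeDatumAt P l), QPilotData (ObΔ P l T) (N P l T))

/-- **`abcExpOn_farFromCusps_of_mu_licenceCells_content_hregC` — F5 (a) AT `σ := Σ_lic`, THE LICENCE BINDER DISCHARGED.** Explicit 2 = [MU-C at Σ_lic] 1 ·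
[CONE-C] 1: for `μ₀ ∈ (0, 1]`, IF at every admissible `(P, l)` on the content locus «`6·(1 + 20·d_mod/l)·(log-diff + log-cond) + 120·d*·l < log q^{∤{2,l}}`» and
every genuine Θ-volume datum `T` the cells `Σ_lic(T)` that OUR typed hull LICENSES (abc-iut-rh2-q2-eq `licenceCells`, chosen realising ideles) satisfy
`B_triv(Σ_lic(T)ᶜ) ≤ (1−μ₀)·T.gap + Tol(P,l)` (⟺ licensed mass `≥ μ₀·T.gap − Tol`, abc-iut-rh2-xi-1's `OffSigmaTolerance` VERBATIM), and [CONE-C] `hregC`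
(abc-iut-C-cert-1's binder VERBATIM), THEN for every `ρ ∈ (0, 1/2]`: **`ABCWithExponentOn {λ | λ ρ-far from the cusps at ∞ and 2} (1/μ₀)`**.
PROOF = abc-iut-rh2-T-1's endpoint p485274 at `σ := Σ_lic` with [LIC-C] := `licenceOn_licenceCells` (true by definition). STRENGTH: implies the endpoint
for EVERY free `σ` (§1 `offTrivialMass_licenceCells_le_of_licenceOn_chosen` + `offSigmaTolerance_mono`) and is its instance — weaker-or-equal binder
by binder. CONDITIONAL; the mass binder engages no tabulated datum (content locus); «follows AS TYPED», nothing more; no side taken on [IUTchIII] Cor. 3.12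
or on any author. [cite: Mochizuki2012, IUTchIV Thm. 1.10 pp. 22–31; Cor. 2.2 (ii)–(iii) pp. 41–48] [cite: MochizukiGenEll2010, Thm 2.1 p.11–12]
[claim: Mochizuki2012, status: disputed] -/
theorem abcExpOn_farFromCusps_of_mu_licenceCells_content_hregC {μ₀ : ℝ} (hμ₀ : 0 < μ₀) (hμ₁ : μ₀ ≤ 1)
    -- [MU-C at Σ_lic] the LICENSED cells retain `≥ μ₀·T.gap − Tol(P,l)` of the mass at every content-locus datum
    (hMuLic : ∀ P : NFPoint, P ∈ UP → ∀ l : ℕ, l.Prime → 5 ≤ l →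
      Cor22.AdmitsCore P → Cor22.CondP2 P l → Cor22.CondP5 P l → Cor22.CondP6 P l →
      6 * ((1 + 20 * (Cor22.dmod P : ℝ) / l) * (P.logDiff + Cor22.logCondAvoid P {2, l}))
          + 120 * (2 ^ 12 * 3 ^ 3 * 5 * (Cor22.dmod P : ℝ) * l) < Cor22.logQAvoid P {2, l} →
      ∀ T : Cor22.ThetaVolumeDatumAt P l, letI := T.instFieldF; letI := T.instNumberFieldF; letI := T.instAlgebraF; letI := T.instFieldK;
        letI := T.instNumberFieldK; letI := T.instAlgebraK; letI := T.instFieldFbar; letI := T.instAlgebraFbar;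
        letI := T.instAlgebraKFbar; letI := T.instIsElliptic;
      OffSigmaTolerance (1 - μ₀) (tol P l) T
        (offTrivialMass
          (settingPrVolSharp (pilotDataOfK T.D T.K) (logvAnalytic_analyticLogv (F := T.K)) (M P l T) (archPk P l T) (archSub P l T) (Ψ P l T)
          (act P l T) (Mmod P l T) (region P l T) (n P l T) (lat P l T) (sig P l T) (split P l T) (qData P l T)
          (exists_realising_qIdeles_pilotDataOfK T.D).choose
          (exists_realising_thetaIdeles_pilotDataOfK T.D).choose
          (exists_realising_qIdeles_pilotDataOfK T.D).choose_spec.1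
          (exists_realising_qIdeles_pilotDataOfK T.D).choose_spec.2.1)
          (licenceCells
            (settingPrVolSharp (pilotDataOfK T.D T.K) (logvAnalytic_analyticLogv (F := T.K)) (M P l T) (archPk P l T) (archSub P l T) (Ψ P l T)
            (act P l T) (Mmod P l T) (region P l T) (n P l T) (lat P l T) (sig P l T) (split P l T) (qData P l T)
            (exists_realising_qIdeles_pilotDataOfK T.D).choose
            (exists_realising_thetaIdeles_pilotDataOfK T.D).choose
            (exists_realising_qIdeles_pilotDataOfK T.D).choose_spec.1
            (exists_realising_qIdeles_pilotDataOfK T.D).choose_spec.2.1))))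
    -- [CONE-C] abc-iut-C-cert-1's `hregC` VERBATIM
    (hregC : ∀ P : NFPoint, P ∈ UP → ∀ l : ℕ, l.Prime → 5 ≤ l →
      Cor22.AdmitsCore P → Cor22.CondP2 P l → Cor22.CondP5 P l → Cor22.CondP6 P l →
      6 * ((1 + 20 * (Cor22.dmod P : ℝ) / l) * (P.logDiff + Cor22.logCondAvoid P {2, l}))
          + 120 * (2 ^ 12 * 3 ^ 3 * 5 * (Cor22.dmod P : ℝ) * l) < Cor22.logQAvoid P {2, l} →
      ∀ T : Cor22.ThetaVolumeDatumAt P l,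
        (letI := T.instFieldF; letI := T.instNumberFieldF; letI := T.instAlgebraF; letI := T.instFieldK
         letI := T.instNumberFieldK; letI := T.instAlgebraK; letI := T.instFieldFbar; letI := T.instAlgebraFbar
         letI := T.instAlgebraKFbar; letI := T.instIsElliptic
         ¬ (∀ p ∈ T.I.supportPrimes, ∀ v w : placesOver (fieldOfModuli T.E) p,
            (Summit.ABC.IUTFork.DHData.ofInput T.I).logQloc p v = (Summit.ABC.IUTFork.DHData.ofInput T.I).logQloc p w)) →
        T.HullEstimateOf
          (((l : ℝ) + 1) / 4 *
            ((1 + 12 * (Cor22.dmod P : ℝ) / l) * (P.logDiff + Cor22.logCondAvoid P {2, l})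
              + 2 * Real.log l + 52
              + 20 / 3 * Real.log (((2 ^ 12 * 3 ^ 3 * 5 * Cor22.dmod P : ℕ) : ℝ) * (l : ℝ))
                * (Nat.primeCounting (2 ^ 12 * 3 ^ 3 * 5 * Cor22.dmod P * l) : ℝ))))
    {ρ : ℝ} (h0 : 0 < ρ) (h2 : ρ ≤ 1 / 2) :
    ABCWithExponentOn {P : NFPoint | P.FarFromCusps ({2} : Finset ℕ) ρ} (1 / μ₀) :=
  abcExpOn_farFromCusps_of_licenceOn_mu_content_hregC hμ₀ hμ₁ M archPk archSub Ψ act Mmod region n lat sig split qData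
    (fun P l T => letI := T.instFieldF; letI := T.instNumberFieldF; letI := T.instAlgebraF; letI := T.instFieldK;
        letI := T.instNumberFieldK; letI := T.instAlgebraK; letI := T.instFieldFbar; letI := T.instAlgebraFbar;
        letI := T.instAlgebraKFbar; letI := T.instIsElliptic;
      licenceCells
        (settingPrVolSharp (pilotDataOfK T.D T.K) (logvAnalytic_analyticLogv (F := T.K)) (M P l T) (archPk P l T) (archSub P l T) (Ψ P l T)
          (act P l T) (Mmod P l T) (region P l T) (n P l T) (lat P l T) (sig P l T) (split P l T) (qData P l T)
          (exists_realising_qIdeles_pilotDataOfK T.D).choose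
          (exists_realising_thetaIdeles_pilotDataOfK T.D).choose
          (exists_realising_qIdeles_pilotDataOfK T.D).choose_spec.1
          (exists_realising_qIdeles_pilotDataOfK T.D).choose_spec.2.1))
    (fun _ _ _ _ _ _ _ _ _ _ _ => licenceOn_licenceCells) hMuLic hregC h0 h2

/-- **`abcExpOn_farFromCusps_of_mu_licenceCells_szpiroBad_degOne` — F5 (a) CONE-FREE AT `σ := Σ_lic`: ONE HYPOTHESIS.** Explicit 1 = [MU₁-bad at Σ_lic]: for
`μ₀ ∈ (0, 1]`, IF at every SZPIRO-BAD admissible RATIONAL `(P, l)` (guard of `Cor22.forall_cor312Of_of_szpiroBad` VERBATIM) and every genuine Θ-volume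
datum `T` the cells OUR hull licenses retain `≥ μ₀·T.gap − Tol(P,l)` of the `(j²−1)`-mass (`OffSigmaTolerance (1−μ₀) (tol P l) T (B_triv(Σ_lic(T)ᶜ))`), THEN for
every `ρ ∈ (0, 1/2]`: **`ABCWithExponentOn {λ ρ-far from the cusps at ∞, 2} (1/μ₀)`** — «S|Σ_lic ⟹ abc with exponent `1/μ₀`» with S|Σ_lic a THEOREM.
PROOF = abc-iut-rh2-T-1's p485274 §2 at `σ := Σ_lic`, [LIC₁-bad] := `licenceOn_licenceCells`. STRENGTH: implies the cone-free endpoint for every free `σ` (§1).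
HONEST STATUS: the binder IS engaged at the tier-1 Frey–Legendre data of p480214, where the full licence fails (`Σ_lic ≠ univ`) and the licensed mass fraction
`μ_lic(T)` is undecided as typed; at each datum the binder holds at `μ₀ := μ_lic(T)` for free (abc-iut-rh2-w-1). CONDITIONAL; nothing asserted about genuine
data; no side taken on [IUTchIII] Cor. 3.12 or on any author. [cite: Mochizuki2012, IUTchIV Cor. 2.2 (ii)–(iii) pp. 41–48] [cite: MochizukiGenEll2010, Thm 2.1 p.11–12]
[claim: Mochizuki2012, status: disputed] -/
theorem abcExpOn_farFromCusps_of_mu_licenceCells_szpiroBad_degOne {μ₀ : ℝ} (hμ₀ : 0 < μ₀) (hμ₁ : μ₀ ≤ 1)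
    -- [MU₁-bad at Σ_lic] the LICENSED cells retain `≥ μ₀·T.gap − Tol(P,l)` of the mass at every Szpiro-bad admissible RATIONAL datum
    (hMuLic₁ : ∀ P : NFPoint, P ∈ UP → P.degree ≤ 1 → ∀ l : ℕ, l.Prime → 5 ≤ l →
      Cor22.AdmitsCore P → Cor22.CondP2 P l → Cor22.CondP5 P l → Cor22.CondP6 P l →
      (((l : ℝ) + 5) / 4 < (Cor22.dmod P : ℝ) ∨
        6 * l * (((l : ℝ) + 5) - 4 * Cor22.dmod P) / (((l : ℝ) + 4) * ((l : ℝ) - 3))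
            * (P.logDiff + (1 - 1 / (l : ℝ)) * Cor22.logCondAvoid P {2, l})
          + 6 * l * ((l : ℝ) + 5) / (((l : ℝ) + 4) * ((l : ℝ) - 3)) * Real.log Real.pi < Cor22.logQAvoid P {2, l}) →
      ∀ T : Cor22.ThetaVolumeDatumAt P l, letI := T.instFieldF; letI := T.instNumberFieldF; letI := T.instAlgebraF; letI := T.instFieldK;
        letI := T.instNumberFieldK; letI := T.instAlgebraK; letI := T.instFieldFbar; letI := T.instAlgebraFbar;
        letI := T.instAlgebraKFbar; letI := T.instIsElliptic;
      OffSigmaTolerance (1 - μ₀) (tol P l) T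
        (offTrivialMass
          (settingPrVolSharp (pilotDataOfK T.D T.K) (logvAnalytic_analyticLogv (F := T.K)) (M P l T) (archPk P l T) (archSub P l T) (Ψ P l T)
          (act P l T) (Mmod P l T) (region P l T) (n P l T) (lat P l T) (sig P l T) (split P l T) (qData P l T)
          (exists_realising_qIdeles_pilotDataOfK T.D).choose
          (exists_realising_thetaIdeles_pilotDataOfK T.D).choose
          (exists_realising_qIdeles_pilotDataOfK T.D).choose_spec.1
          (exists_realising_qIdeles_pilotDataOfK T.D).choose_spec.2.1)
          (licenceCells
            (settingPrVolSharp (pilotDataOfK T.D T.K) (logvAnalytic_analyticLogv (F := T.K)) (M P l T) (archPk P l T) (archSub P l T) (Ψ P l T)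
            (act P l T) (Mmod P l T) (region P l T) (n P l T) (lat P l T) (sig P l T) (split P l T) (qData P l T)
            (exists_realising_qIdeles_pilotDataOfK T.D).choose
            (exists_realising_thetaIdeles_pilotDataOfK T.D).choose
            (exists_realising_qIdeles_pilotDataOfK T.D).choose_spec.1
            (exists_realising_qIdeles_pilotDataOfK T.D).choose_spec.2.1))))
    {ρ : ℝ} (h0 : 0 < ρ) (h2 : ρ ≤ 1 / 2) :
    ABCWithExponentOn {P : NFPoint | P.FarFromCusps ({2} : Finset ℕ) ρ} (1 / μ₀) :=
  abcExpOn_farFromCusps_of_licenceOn_mu_szpiroBad_degOne hμ₀ hμ₁ M archPk archSub Ψ act Mmod region n lat sig split qData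
    (fun P l T => letI := T.instFieldF; letI := T.instNumberFieldF; letI := T.instAlgebraF; letI := T.instFieldK;
        letI := T.instNumberFieldK; letI := T.instAlgebraK; letI := T.instFieldFbar; letI := T.instAlgebraFbar;
        letI := T.instAlgebraKFbar; letI := T.instIsElliptic;
      licenceCells
        (settingPrVolSharp (pilotDataOfK T.D T.K) (logvAnalytic_analyticLogv (F := T.K)) (M P l T) (archPk P l T) (archSub P l T) (Ψ P l T)
          (act P l T) (Mmod P l T) (region P l T) (n P l T) (lat P l T) (sig P l T) (split P l T) (qData P l T)
          (exists_realising_qIdeles_pilotDataOfK T.D).choose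
          (exists_realising_thetaIdeles_pilotDataOfK T.D).choose
          (exists_realising_qIdeles_pilotDataOfK T.D).choose_spec.1
          (exists_realising_qIdeles_pilotDataOfK T.D).choose_spec.2.1))
    (fun _ _ _ _ _ _ _ _ _ _ _ _ => licenceOn_licenceCells) hMuLic₁ h0 h2

/-- **`abc_exp_three_div_of_mu_licenceCells_content_hregC` — SHAPE (c) AT `σ := Σ_lic`: ALL abc TRIPLES, EXPONENT `3/μ₀`, LICENCE BINDER DISCHARGED.**
Explicit 2 = [MU-C at Σ_lic]·[CONE-C] ⟹ `∀ ε > 0 ∃ C > 0`, `c < C·rad(abc)^{3/μ₀+ε}` for EVERY abc triple — abc-iut-rh2-T-1's p483681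
`abc_exp_three_div_of_licenceOn_mu_content_hregC` at `σ := Σ_lic` ([IUTchIV] degree-one line; F1-free, transfer-free). CONDITIONAL; no side taken on [IUTchIII]
Cor. 3.12 or on any author. [cite: Mochizuki2012, IUTchIV Thm. 1.10 pp. 22–31] [claim: Mochizuki2012, status: disputed] -/
theorem abc_exp_three_div_of_mu_licenceCells_content_hregC {μ₀ : ℝ} (hμ₀ : 0 < μ₀) (hμ₁ : μ₀ ≤ 1)
    (hMuLic : ∀ P : NFPoint, P ∈ UP → ∀ l : ℕ, l.Prime → 5 ≤ l →
      Cor22.AdmitsCore P → Cor22.CondP2 P l → Cor22.CondP5 P l → Cor22.CondP6 P l →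
      6 * ((1 + 20 * (Cor22.dmod P : ℝ) / l) * (P.logDiff + Cor22.logCondAvoid P {2, l}))
          + 120 * (2 ^ 12 * 3 ^ 3 * 5 * (Cor22.dmod P : ℝ) * l) < Cor22.logQAvoid P {2, l} →
      ∀ T : Cor22.ThetaVolumeDatumAt P l, letI := T.instFieldF; letI := T.instNumberFieldF; letI := T.instAlgebraF; letI := T.instFieldK;
        letI := T.instNumberFieldK; letI := T.instAlgebraK; letI := T.instFieldFbar; letI := T.instAlgebraFbar;
        letI := T.instAlgebraKFbar; letI := T.instIsElliptic;
      OffSigmaTolerance (1 - μ₀) (tol P l) T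
        (offTrivialMass
          (settingPrVolSharp (pilotDataOfK T.D T.K) (logvAnalytic_analyticLogv (F := T.K)) (M P l T) (archPk P l T) (archSub P l T) (Ψ P l T)
          (act P l T) (Mmod P l T) (region P l T) (n P l T) (lat P l T) (sig P l T) (split P l T) (qData P l T)
          (exists_realising_qIdeles_pilotDataOfK T.D).choose
          (exists_realising_thetaIdeles_pilotDataOfK T.D).choose
          (exists_realising_qIdeles_pilotDataOfK T.D).choose_spec.1
          (exists_realising_qIdeles_pilotDataOfK T.D).choose_spec.2.1)
          (licenceCells
            (settingPrVolSharp (pilotDataOfK T.D T.K) (logvAnalytic_analyticLogv (F := T.K)) (M P l T) (archPk P l T) (archSub P l T) (Ψ P l T)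
            (act P l T) (Mmod P l T) (region P l T) (n P l T) (lat P l T) (sig P l T) (split P l T) (qData P l T)
            (exists_realising_qIdeles_pilotDataOfK T.D).choose
            (exists_realising_thetaIdeles_pilotDataOfK T.D).choose
            (exists_realising_qIdeles_pilotDataOfK T.D).choose_spec.1
            (exists_realising_qIdeles_pilotDataOfK T.D).choose_spec.2.1))))
    (hregC : ∀ P : NFPoint, P ∈ UP → ∀ l : ℕ, l.Prime → 5 ≤ l →
      Cor22.AdmitsCore P → Cor22.CondP2 P l → Cor22.CondP5 P l → Cor22.CondP6 P l →
      6 * ((1 + 20 * (Cor22.dmod P : ℝ) / l) * (P.logDiff + Cor22.logCondAvoid P {2, l}))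
          + 120 * (2 ^ 12 * 3 ^ 3 * 5 * (Cor22.dmod P : ℝ) * l) < Cor22.logQAvoid P {2, l} →
      ∀ T : Cor22.ThetaVolumeDatumAt P l,
        (letI := T.instFieldF; letI := T.instNumberFieldF; letI := T.instAlgebraF; letI := T.instFieldK
         letI := T.instNumberFieldK; letI := T.instAlgebraK; letI := T.instFieldFbar; letI := T.instAlgebraFbar
         letI := T.instAlgebraKFbar; letI := T.instIsElliptic
         ¬ (∀ p ∈ T.I.supportPrimes, ∀ v w : placesOver (fieldOfModuli T.E) p,
            (Summit.ABC.IUTFork.DHData.ofInput T.I).logQloc p v = (Summit.ABC.IUTFork.DHData.ofInput T.I).logQloc p w)) →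
        T.HullEstimateOf
          (((l : ℝ) + 1) / 4 *
            ((1 + 12 * (Cor22.dmod P : ℝ) / l) * (P.logDiff + Cor22.logCondAvoid P {2, l})
              + 2 * Real.log l + 52
              + 20 / 3 * Real.log (((2 ^ 12 * 3 ^ 3 * 5 * Cor22.dmod P : ℕ) : ℝ) * (l : ℝ))
                * (Nat.primeCounting (2 ^ 12 * 3 ^ 3 * 5 * Cor22.dmod P * l) : ℝ))))
    {ε : ℝ} (hε : 0 < ε) :
    ∃ C : ℝ, 0 < C ∧ ∀ a b c : ℕ, IsABCTriple a b c →
      (c : ℝ) < C * ((rad a b c : ℕ) : ℝ) ^ (3 / μ₀ + ε) :=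
  abc_exp_three_div_of_licenceOn_mu_content_hregC hμ₀ hμ₁ M archPk archSub Ψ act Mmod region n lat sig split qData
    (fun P l T => letI := T.instFieldF; letI := T.instNumberFieldF; letI := T.instAlgebraF; letI := T.instFieldK;
        letI := T.instNumberFieldK; letI := T.instAlgebraK; letI := T.instFieldFbar; letI := T.instAlgebraFbar;
        letI := T.instAlgebraKFbar; letI := T.instIsElliptic;
      licenceCells
        (settingPrVolSharp (pilotDataOfK T.D T.K) (logvAnalytic_analyticLogv (F := T.K)) (M P l T) (archPk P l T) (archSub P l T) (Ψ P l T)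
          (act P l T) (Mmod P l T) (region P l T) (n P l T) (lat P l T) (sig P l T) (split P l T) (qData P l T)
          (exists_realising_qIdeles_pilotDataOfK T.D).choose
          (exists_realising_thetaIdeles_pilotDataOfK T.D).choose
          (exists_realising_qIdeles_pilotDataOfK T.D).choose_spec.1
          (exists_realising_qIdeles_pilotDataOfK T.D).choose_spec.2.1))
    (fun _ _ _ _ _ _ _ _ _ _ _ => licenceOn_licenceCells) hMuLic hregC hε

end Exponent

end Summit.ABC.IUTFork.Repair.RH2SigmaHull

end
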